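/-
COR-CM (cell pub-hodgecm2, stage 2 of the Hodge ladder) — count-neutral KERNEL COMBINATORICS «split index-two descent: the distance potential»
(seat prover-pub-hodgecm2-b23-g46-0, binder prover b23, gen 46; claim «SPLIT INDEX-TWO», HOME/INBOX.md l.20957).  Theorems only, on top of gen 41ʼs
`Census/IndexTwoDescent*`, gen 40ʼs `Census/ComplementFacesWeight` (`wt`) and b09ʼs `Census/TwistGenerationDescent` (`descent`) BY NAME; no `decide`,
no certificate, no named fact, no `sorry`; `Interfaces.lean` (C1), every E term, B01, `Transposition/*`, `PortJoin/*`, `D2Bridge/*` untouched.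
HONEST FRAMING: `HC_CM` is NOT proved, here or anywhere in the tree; nothing here is a period, a count of record or a headline.
T5: n/a-class (hypothesis binders: `c * c = 1`, `c ≠ 1`, `c` central, `c ∈ H`, `H.index = 2`, `x ∉ H`, `x * x = 1`); checker: self.
-/
import Summits.HodgeConjecture.CorCM.Census.IndexTwoLifting
import Summits.HodgeConjecture.CorCM.Census.ComplementFacesWeight

/-!
# Split index-two descent, I: the distance potential

Setting of `Census/IndexTwoLifting.lean`: `c ≠ 1` a central involution of the finite group `G`, `H ∋ c` of index two, `x ∉ H`; here moreover the
extension SPLITS, `x * x = 1` (`G = H ⋊ ⟨x⟩`: generalised dihedral groups `D(H)`, every `K × ℤ/2` over `K`, the modular and semidihedral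
`2`-groups, `D₄ × ℤ/2`, `Q₈ × ℤ/2` over `Q₈ × 0`, …).  A type `Ψ` of `(G, c)` is the pair `(res₀ Ψ, res₁ Ψ)` of types of `(H, c)`; its
**DISTANCE** is the number of places of `H` where the two coordinates differ,

  `D(Ψ) = wt (res₁ Ψ) (res₀ Ψ) = #(res₁ Ψ ∖ res₀ Ψ)`   (gen 40ʼs `ComplementFaces.wt`).

* §1 `wt` calculus on `(H, c)`: symmetry `wt T Ψ = wt Ψ T` (`wt_comm`, the bijection `t ↦ c·t`), invariance under simultaneous base change
  (`wt_rt_rt`) and under the split twist `pushTwist = conjPull` (`conjPull_eq_pushTwist_of_sq`, `wt_pushTwist_pushTwist`).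
* §2 **`D` is an invariant of blocks** (`wt_res_rt_coe`, `wt_res_rt_x`, `wt_res_rt`): the blocks of `(G, c)` sort by distance.
* §3 **Descending mixed faces**: through every type of distance `≥ 2` there is a MIXED face (one place in `H`, one in `xH`) whose three other
  corners have distances `D − 1, D − 1, D − 2` (`exists_descending_mixed`); descent data is transported by base change (`descends_rt`).
* §4 **THE DISTANCE DESCENT** (b09ʼs `TwistGeneration.descent` with potential `D` and residue `D ≤ 1`): if a submodule `L` of the bi-marginal-zero
  lattice `Z` holds a descending face through every type of distance `≥ 2`, then **`Z ≤ L ⊔ (Z ⊓ ℤ⟨types of distance ≤ 1⟩)`**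
  (`ker_inf_ker_le_of_descent`) — with `Census/IndexTwoLifting`: **`hodgeSpan (G,c) ≤ ℤ⟨pairs⟩ ⊔ ℤ[G]·𝓕 ⊔ L ⊔ (Z ⊓ ℤ⟨diagonal & neighbour types⟩)`**
  (`hodgeSpan_le_of_lifts_of_descent`).  The residual types are the DIAGONAL ones (`res₀ = res₁`) and the NEIGHBOURS (one differing place); the
  bi-marginal-zero vectors supported there are the circulations of the bidirected cube on the types of `H` (part II).

## References
* [Pohlmann1968] H. Pohlmann, Algebraic cycles on abelian varieties of complex multiplication type, Ann. of Math. 88 (1968), Thm 1.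
-/

namespace Summit.HodgeConjecture.CorCM.Census.IndexTwoDescent

open Finset
open Summit.HodgeConjecture.CorCM.Prior.AllgGroup.RfwfAllgGroup
open Summit.HodgeConjecture.CorCM.Census.BlockParity
open Summit.HodgeConjecture.CorCM.Census.Coinvariant
open Summit.HodgeConjecture.CorCM.Census.ComplementFaces
open Summit.HodgeConjecture.CorCM.Census.TwistGeneration

noncomputable section

/-! ## §1 `wt` calculus -/

section Wt

variable {K : Type*} [Group K] [Fintype K] [DecidableEq K] (c' : K)

/-- For CM types, **`wt` is symmetric**: `#(T ∖ Ψ) = #(Ψ ∖ T)` (the bijection `t ↦ c·t`). [folklore] -/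
theorem wt_comm (hc2' : c' * c' = 1) (T Ψ : CMF K c') : wt c' T Ψ = wt c' Ψ T := by
  unfold wt
  have himg : (T.1 \ Ψ.1).image (fun t => c' * t) = Ψ.1 \ T.1 := by
    ext u
    simp only [mem_image, mem_sdiff]
    constructor
    · rintro ⟨t, ⟨htT, htΨ⟩, rfl⟩
      exact ⟨by_contra fun h => htΨ ((Ψ.2 t).mpr h), (T.2 t).mp htT⟩
    · rintro ⟨huΨ, huT⟩
      refine ⟨c' * u, ⟨?_, (Ψ.2 u).mp huΨ⟩, cmul_cmul c' hc2' u⟩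
      by_contra h
      exact huT ((T.2 u).mpr h)
  rw [← himg, card_image_of_injective _ (mul_right_injective c')]

/-- **`wt` is invariant under a simultaneous base change** of both types. [folklore] -/
theorem wt_rt_rt (q : K) (T Ψ : CMF K c') : wt c' (rt c' q T) (rt c' q Ψ) = wt c' T Ψ := by
  unfold wt
  have himg : (T.1 \ Ψ.1).image (fun t => t * q⁻¹) = (rt c' q T).1 \ (rt c' q Ψ).1 := by
    ext u
    simp only [mem_image, mem_sdiff, mem_rt]
    constructor
    · rintro ⟨t, ⟨htT, htΨ⟩, rfl⟩
      rw [inv_mul_cancel_right]; exact ⟨htT, htΨ⟩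
    · rintro ⟨huT, huΨ⟩
      exact ⟨u * q, ⟨huT, huΨ⟩, mul_inv_cancel_right u q⟩
  rw [← himg, card_image_of_injective _ (mul_left_injective q⁻¹)]

/-- Flipping the FIRST type at an element of `T ∖ Ψ` lowers `wt` by one. [folklore] -/
theorem wt_oflipCM_left_of_notMem (hc2' : c' * c' = 1) {T Ψ : CMF K c'} {d : K} (hd : d ∈ T.1) (hdΨ : d ∉ Ψ.1) :
    wt c' (oflipCM c' hc2' d T) Ψ + 1 = wt c' T Ψ := by
  rw [wt_comm c' hc2', wt_comm c' hc2' T, ← oflipCM_cmul c' hc2']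
  have hcdΨ : c' * d ∈ Ψ.1 := by by_contra h; exact hdΨ ((Ψ.2 d).mpr h)
  have hcdT : c' * d ∉ T.1 := (T.2 d).mp hd
  exact wt_oflipCM_of_notMem c' hc2' hcdΨ hcdT

end Wt

variable {G : Type*} [Group G] [Fintype G] [DecidableEq G] {c : G}
variable {H : Subgroup G} [DecidablePred (· ∈ H)]

omit [Fintype G] [DecidableEq G] [DecidablePred (· ∈ H)] in
/-- In the split case `x * x = 1` we have `x⁻¹ = x`. [folklore] -/
theorem inv_eq_self_of_sq {x : G} (hxx : x * x = 1) : x⁻¹ = x := inv_eq_of_mul_eq_one_right hxx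

/-- **In the split case the two twists agree**: `conjPull = pushTwist` (`x⁻¹ h x = x h x`). [folklore] -/
theorem conjPull_eq_pushTwist_of_sq (hcH : c ∈ H) (hcen : ∀ g : G, g * c = c * g) (hH : H.index = 2) {x : G} (hx : x ∉ H)
    (hxx : x * x = 1) (T : CMF H ⟨c, hcH⟩) : conjPull hcH hcen hH x T = pushTwist hcH hcen hH hx T := by
  apply Subtype.ext; ext h
  rw [mem_conjPull, mem_pushTwist]
  have he : (⟨x⁻¹ * (h : G) * x, inv_mul_mul_mem hH x h⟩ : H) = ⟨x * (h : G) * x, mul_mul_mem hH hx h⟩ :=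
    Subtype.ext (by simp [inv_eq_self_of_sq hxx])
  rw [he]

/-- **`wt` is invariant under the split twist.** [folklore] -/
theorem wt_pushTwist_pushTwist (hcH : c ∈ H) (hcen : ∀ g : G, g * c = c * g) (hH : H.index = 2) {x : G} (hx : x ∉ H)
    (hxx : x * x = 1) (T Ψ : CMF H ⟨c, hcH⟩) :
    wt (⟨c, hcH⟩ : H) (pushTwist hcH hcen hH hx T) (pushTwist hcH hcen hH hx Ψ) = wt (⟨c, hcH⟩ : H) T Ψ := by
  unfold wt
  -- the involution `h ↦ x h x` of `H`
  let φ : H → H := fun h => ⟨x * (h : G) * x, mul_mul_mem hH hx h⟩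
  have hφφ : ∀ h : H, φ (φ h) = h := fun h => Subtype.ext (by
    show x * (x * (h : G) * x) * x = (h : G)
    rw [show x * (x * (h : G) * x) * x = (x * x) * (h : G) * (x * x) by group, hxx, one_mul, mul_one])
  have himg : (T.1 \ Ψ.1).image φ = (pushTwist hcH hcen hH hx T).1 \ (pushTwist hcH hcen hH hx Ψ).1 := by
    ext u
    simp only [mem_image, mem_sdiff, mem_pushTwist]
    constructor
    · rintro ⟨t, ⟨htT, htΨ⟩, rfl⟩
      have e : (⟨x * ((φ t : H) : G) * x, mul_mul_mem hH hx (φ t)⟩ : H) = t := hφφ t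
      rw [e]; exact ⟨htT, htΨ⟩
    · rintro ⟨huT, huΨ⟩
      exact ⟨φ u, ⟨huT, huΨ⟩, hφφ u⟩
  rw [← himg, card_image_of_injective _ (Function.LeftInverse.injective hφφ)]

/-! ## §2 The distance is a block invariant -/

/-- `D(Ψ·h⁻¹) = D(Ψ)` for `h ∈ H`. [folklore] -/
theorem wt_res_rt_coe (hcH : c ∈ H) (hcen : ∀ g : G, g * c = c * g) (x : G) (h : H) (Ψ : CMF G c) :
    wt (⟨c, hcH⟩ : H) (res₁ hcH hcen x (rt c (h : G) Ψ)) (res₀ hcH (rt c (h : G) Ψ)) =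
      wt (⟨c, hcH⟩ : H) (res₁ hcH hcen x Ψ) (res₀ hcH Ψ) := by
  rw [res₀_rt_coe, res₁_rt_coe, wt_rt_rt]

/-- `D(Ψ·x⁻¹) = D(Ψ)` in the split case. [folklore] -/
theorem wt_res_rt_x (hcH : c ∈ H) (hcen : ∀ g : G, g * c = c * g) (hc2 : c * c = 1) (hH : H.index = 2) {x : G} (hx : x ∉ H)
    (hxx : x * x = 1) (Ψ : CMF G c) :
    wt (⟨c, hcH⟩ : H) (res₁ hcH hcen x (rt c x Ψ)) (res₀ hcH (rt c x Ψ)) = wt (⟨c, hcH⟩ : H) (res₁ hcH hcen x Ψ) (res₀ hcH Ψ) := by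
  rw [res₀_rt_x hcH hcen hH x, res₁_rt_x hcH hcen hH hx, conjPull_eq_pushTwist_of_sq hcH hcen hH hx hxx,
    wt_pushTwist_pushTwist hcH hcen hH hx hxx, wt_comm _ (csub_mul_csub hcH hc2)]

/-- **THE DISTANCE IS A BLOCK INVARIANT** (split case): `D(Ψ·Q⁻¹) = D(Ψ)` for every `Q ∈ G`. [folklore] -/
theorem wt_res_rt (hcH : c ∈ H) (hcen : ∀ g : G, g * c = c * g) (hc2 : c * c = 1) (hH : H.index = 2) {x : G} (hx : x ∉ H)
    (hxx : x * x = 1) (Q : G) (Ψ : CMF G c) :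
    wt (⟨c, hcH⟩ : H) (res₁ hcH hcen x (rt c Q Ψ)) (res₀ hcH (rt c Q Ψ)) = wt (⟨c, hcH⟩ : H) (res₁ hcH hcen x Ψ) (res₀ hcH Ψ) := by
  by_cases hQ : Q ∈ H
  · exact wt_res_rt_coe hcH hcen x ⟨Q, hQ⟩ Ψ
  · obtain ⟨h, rfl⟩ := exists_eq_mul_of_not_mem hH hx hQ
    rw [rt_mul, wt_res_rt_x hcH hcen hc2 hH hx hxx, wt_res_rt_coe hcH hcen x h]

/-- Types in the same block have the same distance. [folklore] -/
theorem wt_res_eq_of_blk_eq (hcH : c ∈ H) (hcen : ∀ g : G, g * c = c * g) (hc2 : c * c = 1) (hH : H.index = 2) {x : G} (hx : x ∉ H)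
    (hxx : x * x = 1) {Ψ Ψ' : CMF G c} (h : blk c Ψ = blk c Ψ') :
    wt (⟨c, hcH⟩ : H) (res₁ hcH hcen x Ψ) (res₀ hcH Ψ) = wt (⟨c, hcH⟩ : H) (res₁ hcH hcen x Ψ') (res₀ hcH Ψ') := by
  obtain ⟨Q, rfl⟩ := Quotient.exact h
  rw [wt_res_rt hcH hcen hc2 hH hx hxx]

/-! ## §3 Descending mixed faces -/

/-- **Through every type of distance `≥ 2` there is a DESCENDING MIXED FACE**: flipping one differing place in the `0`-coordinate (at `d ∈ H`)
and another in the `1`-coordinate (at `x·d'`) lowers the distance of the three other corners to `D − 1, D − 1, D − 2`. [folklore] -/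
theorem exists_descending_mixed (hcH : c ∈ H) (hcen : ∀ g : G, g * c = c * g) (hc2 : c * c = 1) {x : G} (hx : x ∉ H)
    (Ψ : CMF G c) (h2 : 2 ≤ wt (⟨c, hcH⟩ : H) (res₁ hcH hcen x Ψ) (res₀ hcH Ψ)) :
    ∃ d d' : H, d ∈ (res₁ hcH hcen x Ψ).1 ∧ d ∉ (res₀ hcH Ψ).1 ∧ d' ∈ (res₁ hcH hcen x Ψ).1 ∧ d' ∉ (res₀ hcH Ψ).1 ∧ d ≠ d' ∧
      wt (⟨c, hcH⟩ : H) (res₁ hcH hcen x (oflipCM c hc2 (d : G) Ψ)) (res₀ hcH (oflipCM c hc2 (d : G) Ψ)) + 1 =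
        wt (⟨c, hcH⟩ : H) (res₁ hcH hcen x Ψ) (res₀ hcH Ψ) ∧
      wt (⟨c, hcH⟩ : H) (res₁ hcH hcen x (oflipCM c hc2 (x * (d' : G)) Ψ)) (res₀ hcH (oflipCM c hc2 (x * (d' : G)) Ψ)) + 1 =
        wt (⟨c, hcH⟩ : H) (res₁ hcH hcen x Ψ) (res₀ hcH Ψ) ∧
      wt (⟨c, hcH⟩ : H) (res₁ hcH hcen x (oflipCM c hc2 (d : G) (oflipCM c hc2 (x * (d' : G)) Ψ)))
          (res₀ hcH (oflipCM c hc2 (d : G) (oflipCM c hc2 (x * (d' : G)) Ψ))) + 2 =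
        wt (⟨c, hcH⟩ : H) (res₁ hcH hcen x Ψ) (res₀ hcH Ψ) := by
  obtain ⟨d, d', hd1, hd0, hd'1, hd'0, hne⟩ := exists_two_devs _ h2
  have hc2' := csub_mul_csub hcH hc2
  refine ⟨d, d', hd1, hd0, hd'1, hd'0, hne, ?_, ?_, ?_⟩
  · -- `0`-coordinate flip at `d`
    rw [res₀_oflipCM_coe, res₁_oflipCM_coe hcH hcen hc2 hx]
    exact wt_oflipCM_of_notMem _ hc2' hd1 hd0
  · -- `1`-coordinate flip at `x·d'`
    rw [res₀_oflipCM_mul hcH hcen hc2 hx, res₁_oflipCM_mul]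
    exact wt_oflipCM_left_of_notMem _ hc2' hd'1 hd'0
  · -- both
    rw [res₀_oflipCM_coe, res₁_oflipCM_coe hcH hcen hc2 hx, res₀_oflipCM_mul hcH hcen hc2 hx, res₁_oflipCM_mul]
    have hd1' : d ∈ (oflipCM (⟨c, hcH⟩ : H) hc2' d' (res₁ hcH hcen x Ψ)).1 := by
      have hnot : d ∉ orb (⟨c, hcH⟩ : H) d' := by
        rw [mem_orb]
        rintro (rfl | rfl)
        · exact hne rfl
        · exact ((res₁ hcH hcen x Ψ).2 d').mp hd'1 hd1
      change d ∈ oflip (⟨c, hcH⟩ : H) d' (res₁ hcH hcen x Ψ).1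
      rw [oflip, mem_symmDiff]
      exact Or.inl ⟨hd1, hnot⟩
    have h1 := wt_oflipCM_of_notMem _ hc2' (Ψ := res₀ hcH Ψ) hd1' hd0
    have h2' := wt_oflipCM_left_of_notMem _ hc2' (Ψ := res₀ hcH Ψ) hd'1 hd'0
    omega

/-- **Descent data is transported by base change**: if the face at `(t, t')` descends at `Ψ`, the face at `(tQ⁻¹, t'Q⁻¹)` descends at `Ψ·Q⁻¹`
and is the base change of the former. [folklore] -/
theorem descends_rt (hcH : c ∈ H) (hcen : ∀ g : G, g * c = c * g) (hc2 : c * c = 1) (hH : H.index = 2) {x : G} (hx : x ∉ H)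
    (hxx : x * x = 1) (Q : G) (Ψ : CMF G c) (t t' : G) :
    Finsupp.mapDomain (rt c Q) (gface c hc2 Ψ t t') = gface c hc2 (rt c Q Ψ) (t * Q⁻¹) (t' * Q⁻¹) ∧
    wt (⟨c, hcH⟩ : H) (res₁ hcH hcen x (oflipCM c hc2 (t * Q⁻¹) (rt c Q Ψ))) (res₀ hcH (oflipCM c hc2 (t * Q⁻¹) (rt c Q Ψ))) =
      wt (⟨c, hcH⟩ : H) (res₁ hcH hcen x (oflipCM c hc2 t Ψ)) (res₀ hcH (oflipCM c hc2 t Ψ)) ∧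
    wt (⟨c, hcH⟩ : H) (res₁ hcH hcen x (oflipCM c hc2 (t' * Q⁻¹) (rt c Q Ψ))) (res₀ hcH (oflipCM c hc2 (t' * Q⁻¹) (rt c Q Ψ))) =
      wt (⟨c, hcH⟩ : H) (res₁ hcH hcen x (oflipCM c hc2 t' Ψ)) (res₀ hcH (oflipCM c hc2 t' Ψ)) ∧
    wt (⟨c, hcH⟩ : H) (res₁ hcH hcen x (oflipCM c hc2 (t * Q⁻¹) (oflipCM c hc2 (t' * Q⁻¹) (rt c Q Ψ))))
        (res₀ hcH (oflipCM c hc2 (t * Q⁻¹) (oflipCM c hc2 (t' * Q⁻¹) (rt c Q Ψ)))) =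
      wt (⟨c, hcH⟩ : H) (res₁ hcH hcen x (oflipCM c hc2 t (oflipCM c hc2 t' Ψ))) (res₀ hcH (oflipCM c hc2 t (oflipCM c hc2 t' Ψ))) := by
  refine ⟨mapDomain_rt_gface c hc2 Q Ψ t t', ?_, ?_, ?_⟩
  · rw [← rt_oflipCM, wt_res_rt hcH hcen hc2 hH hx hxx]
  · rw [← rt_oflipCM, wt_res_rt hcH hcen hc2 hH hx hxx]
  · rw [← rt_oflipCM, ← rt_oflipCM, wt_res_rt hcH hcen hc2 hH hx hxx]

/-! ## §4 The distance descent -/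

/-- **THE DISTANCE DESCENT.**  If `L` holds, through every type of distance `≥ 2`, a face whose three other corners have smaller distance, then
every vector is congruent modulo `L` to one supported on types of distance `≤ 1` (the DIAGONAL and NEIGHBOUR types). [folklore] -/
theorem exists_residual_of_descent (hcH : c ∈ H) (hcen : ∀ g : G, g * c = c * g) (hc2 : c * c = 1) (x : G) (L : Submodule ℤ (CMF G c →₀ ℤ))
    (hL : ∀ Ψ : CMF G c, 2 ≤ wt (⟨c, hcH⟩ : H) (res₁ hcH hcen x Ψ) (res₀ hcH Ψ) → ∃ t t' : G, gface c hc2 Ψ t t' ∈ L ∧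
      wt (⟨c, hcH⟩ : H) (res₁ hcH hcen x (oflipCM c hc2 t Ψ)) (res₀ hcH (oflipCM c hc2 t Ψ)) <
        wt (⟨c, hcH⟩ : H) (res₁ hcH hcen x Ψ) (res₀ hcH Ψ) ∧
      wt (⟨c, hcH⟩ : H) (res₁ hcH hcen x (oflipCM c hc2 t' Ψ)) (res₀ hcH (oflipCM c hc2 t' Ψ)) <
        wt (⟨c, hcH⟩ : H) (res₁ hcH hcen x Ψ) (res₀ hcH Ψ) ∧
      wt (⟨c, hcH⟩ : H) (res₁ hcH hcen x (oflipCM c hc2 t (oflipCM c hc2 t' Ψ))) (res₀ hcH (oflipCM c hc2 t (oflipCM c hc2 t' Ψ))) <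
        wt (⟨c, hcH⟩ : H) (res₁ hcH hcen x Ψ) (res₀ hcH Ψ))
    (y : CMF G c →₀ ℤ) :
    ∃ y' : CMF G c →₀ ℤ, y - y' ∈ L ∧ ∀ Ψ ∈ y'.support, wt (⟨c, hcH⟩ : H) (res₁ hcH hcen x Ψ) (res₀ hcH Ψ) ≤ 1 :=
  descent c (fun Ψ => wt (⟨c, hcH⟩ : H) (res₁ hcH hcen x Ψ) (res₀ hcH Ψ))
    (fun Ψ => wt (⟨c, hcH⟩ : H) (res₁ hcH hcen x Ψ) (res₀ hcH Ψ) ≤ 1) hc2 L (fun Ψ hΨ => hL Ψ (by push Not at hΨ; omega)) y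

/-- In the split case the hypothesis of the descent is met by MIXED faces: it suffices that `L` contains, through every type of distance `≥ 2`,
the mixed face at SOME pair of differing places `(d, x·d')`, `d ≠ d'`. [folklore] -/
theorem exists_residual_of_mixed (hcH : c ∈ H) (hcen : ∀ g : G, g * c = c * g) (hc2 : c * c = 1) {x : G} (hx : x ∉ H)
    (L : Submodule ℤ (CMF G c →₀ ℤ))
    (hL : ∀ Ψ : CMF G c, 2 ≤ wt (⟨c, hcH⟩ : H) (res₁ hcH hcen x Ψ) (res₀ hcH Ψ) →
      ∀ d d' : H, d ∈ (res₁ hcH hcen x Ψ).1 → d ∉ (res₀ hcH Ψ).1 → d' ∈ (res₁ hcH hcen x Ψ).1 → d' ∉ (res₀ hcH Ψ).1 → d ≠ d' →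
        gface c hc2 Ψ (d : G) (x * (d' : G)) ∈ L)
    (y : CMF G c →₀ ℤ) :
    ∃ y' : CMF G c →₀ ℤ, y - y' ∈ L ∧ ∀ Ψ ∈ y'.support, wt (⟨c, hcH⟩ : H) (res₁ hcH hcen x Ψ) (res₀ hcH Ψ) ≤ 1 := by
  refine exists_residual_of_descent hcH hcen hc2 x L (fun Ψ h2 => ?_) y
  obtain ⟨d, d', hd1, hd0, hd'1, hd'0, hne, e1, e2, e3⟩ := exists_descending_mixed hcH hcen hc2 hx Ψ h2
  exact ⟨d, x * (d' : G), hL Ψ h2 d d' hd1 hd0 hd'1 hd'0 hne, by omega, by omega, by omega⟩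

/-- **THE BI-MARGINAL-ZERO LATTICE DESCENDS TO THE RESIDUAL TYPES**: for `L ≤ Z = ker marg₀ ⊓ ker marg₁` as in the descent,
`Z ≤ L ⊔ (Z ⊓ ℤ⟨types of distance ≤ 1⟩)`. [folklore] -/
theorem ker_inf_ker_le_of_descent (hcH : c ∈ H) (hcen : ∀ g : G, g * c = c * g) (hc2 : c * c = 1) (x : G)
    (L : Submodule ℤ (CMF G c →₀ ℤ)) (hLZ : L ≤ LinearMap.ker (marg₀ hcH) ⊓ LinearMap.ker (marg₁ hcH hcen x))
    (hL : ∀ Ψ : CMF G c, 2 ≤ wt (⟨c, hcH⟩ : H) (res₁ hcH hcen x Ψ) (res₀ hcH Ψ) → ∃ t t' : G, gface c hc2 Ψ t t' ∈ L ∧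
      wt (⟨c, hcH⟩ : H) (res₁ hcH hcen x (oflipCM c hc2 t Ψ)) (res₀ hcH (oflipCM c hc2 t Ψ)) <
        wt (⟨c, hcH⟩ : H) (res₁ hcH hcen x Ψ) (res₀ hcH Ψ) ∧
      wt (⟨c, hcH⟩ : H) (res₁ hcH hcen x (oflipCM c hc2 t' Ψ)) (res₀ hcH (oflipCM c hc2 t' Ψ)) <
        wt (⟨c, hcH⟩ : H) (res₁ hcH hcen x Ψ) (res₀ hcH Ψ) ∧
      wt (⟨c, hcH⟩ : H) (res₁ hcH hcen x (oflipCM c hc2 t (oflipCM c hc2 t' Ψ))) (res₀ hcH (oflipCM c hc2 t (oflipCM c hc2 t' Ψ))) <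
        wt (⟨c, hcH⟩ : H) (res₁ hcH hcen x Ψ) (res₀ hcH Ψ)) :
    LinearMap.ker (marg₀ hcH) ⊓ LinearMap.ker (marg₁ hcH hcen x) ≤
      L ⊔ (LinearMap.ker (marg₀ hcH) ⊓ LinearMap.ker (marg₁ hcH hcen x) ⊓
        Finsupp.supported ℤ ℤ {Ψ : CMF G c | wt (⟨c, hcH⟩ : H) (res₁ hcH hcen x Ψ) (res₀ hcH Ψ) ≤ 1}) := by
  intro z hz
  obtain ⟨z', hzz', hz'⟩ := exists_residual_of_descent hcH hcen hc2 x L hL z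
  have hz'Z : z' ∈ LinearMap.ker (marg₀ hcH) ⊓ LinearMap.ker (marg₁ hcH hcen x) := by
    have h : z' = z - (z - z') := by abel
    rw [h]
    exact Submodule.sub_mem _ hz (hLZ hzz')
  have h : z = (z - z') + z' := by abel
  rw [h]
  have hsupp : z' ∈ Finsupp.supported ℤ ℤ {Ψ : CMF G c | wt (⟨c, hcH⟩ : H) (res₁ hcH hcen x Ψ) (res₀ hcH Ψ) ≤ 1} := by
    rw [Finsupp.mem_supported]
    intro Ψ hΨ
    exact hz' Ψ (Finset.mem_coe.mp hΨ)
  exact Submodule.add_mem _ (Submodule.mem_sup_left hzz') (Submodule.mem_sup_right ⟨hz'Z, hsupp⟩)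

/-- **LIFTING + DESCENT**: for a split index-two extension, the Hodge lattice of `(G, c)` is generated by pairs, the base changes of the lifts
`𝓕` of an `H`-generating family, any submodule `L ≤ Z` holding a descending face through every type of distance `≥ 2`, and the
bi-marginal-zero vectors supported on the residual (diagonal and neighbour) types. [folklore] -/
theorem hodgeSpan_le_of_lifts_of_descent (hcH : c ∈ H) (hc2 : c * c = 1) (hc1 : c ≠ 1) (hcen : ∀ g : G, g * c = c * g)
    (hH : H.index = 2) {x : G} (hx : x ∉ H) (S : Finset (CMF H ⟨c, hcH⟩ →₀ ℤ))
    (hS : hodgeSpan (⟨c, hcH⟩ : H) (csub_mul_csub hcH hc2) ≤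
      Submodule.span ℤ (pairSet (⟨c, hcH⟩ : H)) ⊔ Submodule.span ℤ (translates (⟨c, hcH⟩ : H) S))
    (M : Submodule ℤ (CMF G c →₀ ℤ)) (hMH : M ≤ hodgeSpan c hc2) (hM : ∀ Q : G, ∀ y ∈ M, Finsupp.mapDomain (rt c Q) y ∈ M)
    (hlift : ∀ f ∈ S, ∃ F ∈ M, marg₀ hcH F = f ∧ marg₁ hcH hcen x F = 0)
    (L : Submodule ℤ (CMF G c →₀ ℤ)) (hLZ : L ≤ LinearMap.ker (marg₀ hcH) ⊓ LinearMap.ker (marg₁ hcH hcen x))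
    (hL : ∀ Ψ : CMF G c, 2 ≤ wt (⟨c, hcH⟩ : H) (res₁ hcH hcen x Ψ) (res₀ hcH Ψ) → ∃ t t' : G, gface c hc2 Ψ t t' ∈ L ∧
      wt (⟨c, hcH⟩ : H) (res₁ hcH hcen x (oflipCM c hc2 t Ψ)) (res₀ hcH (oflipCM c hc2 t Ψ)) <
        wt (⟨c, hcH⟩ : H) (res₁ hcH hcen x Ψ) (res₀ hcH Ψ) ∧
      wt (⟨c, hcH⟩ : H) (res₁ hcH hcen x (oflipCM c hc2 t' Ψ)) (res₀ hcH (oflipCM c hc2 t' Ψ)) <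
        wt (⟨c, hcH⟩ : H) (res₁ hcH hcen x Ψ) (res₀ hcH Ψ) ∧
      wt (⟨c, hcH⟩ : H) (res₁ hcH hcen x (oflipCM c hc2 t (oflipCM c hc2 t' Ψ))) (res₀ hcH (oflipCM c hc2 t (oflipCM c hc2 t' Ψ))) <
        wt (⟨c, hcH⟩ : H) (res₁ hcH hcen x Ψ) (res₀ hcH Ψ)) :
    hodgeSpan c hc2 ≤ ((Submodule.span ℤ (pairSet c) ⊔ M) ⊔ L) ⊔
      (LinearMap.ker (marg₀ hcH) ⊓ LinearMap.ker (marg₁ hcH hcen x) ⊓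
        Finsupp.supported ℤ ℤ {Ψ : CMF G c | wt (⟨c, hcH⟩ : H) (res₁ hcH hcen x Ψ) (res₀ hcH Ψ) ≤ 1}) := by
  refine le_trans (hodgeSpan_le_sup_ker_of_lifts hcH hc2 hc1 hcen hH hx S hS M hMH hM hlift) ?_
  refine sup_le (le_sup_of_le_left le_sup_left) ?_
  refine le_trans (ker_inf_ker_le_of_descent hcH hcen hc2 x L hLZ hL) ?_
  exact sup_le (le_sup_of_le_left le_sup_right) le_sup_right

end

end Summit.HodgeConjecture.CorCM.Census.IndexTwoDescent
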